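import Literature.AnabelianGeometry.EtaleTheta.GalSectDotCCuspStructureGroupIsoEmpty
import Literature.AnabelianGeometry.EtaleTheta.SettingModelKrullCuspCommensuratorC
import Literature.FieldTheory.AbsoluteGaloisGroupNoInvolution
import HarnessLib

/-!
# C7e at the ORBICURVE cusp pair of the commutator-axis Krull carrier (`D_C = Comm_{Π^tp_C}(inclX D_x)`, `I_C = D_C ∩ Ker augC`):
# the inertia is STILL CENTRAL and torsion-free, so clause (1) and clause (2) both FAIL there too

S. Mochizuki, [EtTh] Def. 1.7 p. 27, Thm. 1.10 (iii) p. 30 [cite: MochizukiEtTh2009, Thm 1.10 (iii) p.30]; [GalSect] §4 p. 33 («`I_x ≅ Ẑ(1)` …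
torsor over `H¹(G_K, Ẑ(1)) ≅ (K^×)^∧`») [cite: MochizukiGalSect2005, §4 p.33]; [SemiAnbd] Thm. 6.5 (ii) p. 71 [cite: MochizukiSemiAnbd2006, Thm 6.5 (ii) p.71];
Neukirch–Schmidt–Wingberg I §2 [cite: NeukirchSchmidtWingberg2008, I §2 and II §7].  abc-iut cell, layer L2, seat abc-iut-w5-d029 (gen 6); C7e
lineage (abc-iut-L2-lead R404), File 4 — the ONE configuration the census of record (p452745 / p454786 / p456299) left open: abc-iut-L2-t5's
C7d-compliant ORBICURVE pair at `inversionModelκ′` (p455817): `D_C = inclX(D_x) ∪ inclX(D_x)·g₁`, `g₁ := inclX(inl(ab))·ε_±` CENTRALISING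
`inclX(D_x)` (`sqrt_conj_inclX_eq`), `g₁² = inclX(c)` (`sqrtCuspκ_sq`), `augC(ε_±) = 1`.  Hence `I_C = inclX(I_x) ∪ inclX(I_x)·g₁` is CENTRAL in
`D_C`, abelian and TORSION-FREE, and both C7e clauses fail at `(D_C, I_C)` exactly as at `(inclX D_x, inclX I_x)`:
* §1 generic (proof-only): `CuspPair.isMulCommutative_I_of_conj_eq`, `contH1_eq_one_of_pow_eq_one_of_torsionFree`,
  **`isEmpty_kxHat_mulEquiv_resKer_of_torsionFree`** (p456299's obstruction with «`I ≅ Ẑ`» weakened to «torsion-free», any proof of `I ≤ D`);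
* §2 class (b) data `sqrtCuspInvκ` (`g₁`), `decompCκ'` (`D_C`), **`pairCκ'`** and their structure (`mem_decompCκ'_iff` BY NAME from p455817,
  `mem_inertiaCκ'_iff`, **`conj_eq_of_mem_pairCκ'`** = central inertia, `augC_image_decompCκ'`);
* §3 **`not_isCyclotomic_pairCκ'`** (clause (1) REFUTED); §4 **`eq_one_of_pow_eq_one_inertiaCκ'`** (`I_C` torsion-free: `i² ∈ inclX(I_x)`, and
  `i = inclX(inl c^t)·g₁` with `i² = 1` would force «`2t + 1 = 0`» in `Ẑ`, impossible at level `2`), **`isEmpty_structureGroupIso_pairCκ'`**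
  (clause (2) REFUTED); §5 `augC_eq_of_comp_inclX` (the C-level augmentation is UNIQUE — `G_{ℚ_p}` has no involution, abc-iut-w6-d067), so
  **every `DotCCusp` at `κ′` whose pair has `D = D_C`** fails clause (1) and admits no structure-group identification
  (`not_isCyclotomicInertia_of_pair_D_eq_decompCκ'`, `isEmpty_structureGroupIso_of_pair_D_eq_decompCκ'`).
CENSUS TOKEN (row `MuTwoSetting.DotCCusp`, C7e): at `κ′` both clauses are refuted for the orbicurve pair too — the census is closed for `inclX D_x`
AND its commensurator.  HONEST FRAMING: semi-synthetic model = consistency evidence only; classical group theory under OUR kernel check;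
nothing of [EtTh]/[GalSect]/[SemiAnbd] asserted; no side taken on [IUTchIII] Cor. 3.12; typed ≠ proved.
-/

noncomputable section

namespace Literature.AnabelianGeometry.EtaleTheta

open Literature.AnabelianGeometry.SemiGraphs _root_.Topology
open scoped Pointwise IsMulCommutative commutatorElement

/-! ### §1. Generic: the torsion obstruction with «`I` torsion-free» -/

namespace GalSect.CuspPair

variable {Γ : Type*} [Group Γ] [TopologicalSpace Γ] [IsTopologicalGroup Γ] (P : CuspPair Γ)

omit [IsTopologicalGroup Γ] in
/-- A pair whose decomposition group CENTRALISES its inertia has ABELIAN inertia. [cite: MochizukiGalSect2005, §4 p.33] -/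
theorem isMulCommutative_I_of_conj_eq (hcomm : ∀ d ∈ P.D, ∀ i ∈ P.I, d * i * d⁻¹ = i) : IsMulCommutative P.I :=
  ⟨⟨fun a b => Subtype.ext (by
    have h := hcomm (a : Γ) (P.I_le a.2) (b : Γ) b.2
    calc (a : Γ) * b = (a : Γ) * b * (a : Γ)⁻¹ * a := by group
      _ = b * a := by rw [h])⟩⟩

omit [IsTopologicalGroup Γ] in
/-- «`I` torsion-free» seen inside `↥D`. [cite: MochizukiGalSect2005, §4 p.33] -/
theorem ID_eq_one_of_pow_eq_one_of_torsionFree (htf : ∀ i ∈ P.I, ∀ n : ℕ, n ≠ 0 → i ^ n = 1 → i = 1) (a : P.ID) (n : ℕ)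
    (hn : n ≠ 0) (ha : a ^ n = 1) : a = 1 := by
  have h1 : ((a : P.D) : Γ) ^ n = 1 := by
    have := congrArg (fun b : P.ID => (((b : P.D)) : Γ)) ha
    simpa using this
  have h2 : ((a : P.D) : Γ) = 1 := htf _ a.2 n hn h1
  apply Subtype.ext; apply Subtype.ext
  exact h2
/-- **`H¹(D, I)` is torsion-free at a pair with CENTRAL, TORSION-FREE inertia** (p456299's `contH1_eq_one_of_pow_eq_one` with «`I ≅ Ẑ`»
weakened to torsion-freeness). [cite: NeukirchSchmidtWingberg2008, I §2 and II §7] -/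
theorem contH1_eq_one_of_pow_eq_one_of_torsionFree [IsMulCommutative P.I] (hcomm : ∀ d ∈ P.D, ∀ i ∈ P.I, d * i * d⁻¹ = i)
    (htf : ∀ i ∈ P.I, ∀ n : ℕ, n ≠ 0 → i ^ n = 1 → i = 1)
    (x : haveI := P.ID_normal; ContH1 (MonoidHom.id P.D) P.ID (⊤ : Subgroup P.D)) {n : ℕ} (hn : n ≠ 0)
    (hx : haveI := P.ID_normal; x ^ n = 1) :
    haveI := P.ID_normal; x = 1 := by
  haveI := P.ID_normal
  refine ContH1.eq_one_of_pow_eq_one_of_conjNormal_eq (fun h a => ?_)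
    (fun a n hn ha => P.ID_eq_one_of_pow_eq_one_of_torsionFree htf a n hn ha) x hn hx
  apply Subtype.ext; apply Subtype.ext
  rw [MulAut.conjNormal_apply, MonoidHom.id_apply]
  change ((h : P.D) : Γ) * ((a : P.D) : Γ) * ((h : P.D) : Γ)⁻¹ = ((a : P.D) : Γ)
  exact hcomm _ (h : P.D).2 _ a.2
/-- **No identification of structure groups at central torsion-free inertia**: there is NO group isomorphism
`(K^×)^∧ ≃* Ker(res : H¹(D, I) → H¹(I, I))` (for any proof of `I ≤ D` indexing the kernel): `η(−1)` has order `2` (abc-iut-w5-d062's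
`toKxHat_neg_one_ne_one`), the kernel is torsion-free. [cite: MochizukiGalSect2005, §4 p.33] -/
theorem isEmpty_kxHat_mulEquiv_resKer_of_torsionFree {p : ℕ} [Fact p.Prime] (X : TemperedCurve p) [IsMulCommutative P.I]
    (hcomm : ∀ d ∈ P.D, ∀ i ∈ P.I, d * i * d⁻¹ = i) (htf : ∀ i ∈ P.I, ∀ n : ℕ, n ≠ 0 → i ^ n = 1 → i = 1)
    (hle : P.ID ≤ (⊤ : Subgroup P.D)) :
    haveI := P.ID_normal
    IsEmpty (KxHat X ≃* ↥(ContH1.resKer P.ID (⊤ : Subgroup P.D) hle)) := by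
  haveI := P.ID_normal
  refine ⟨fun κ => toKxHat_neg_one_ne_one X ?_⟩
  have h1 : (κ (toKxHat X (-1))) ^ 2 = 1 := by rw [← map_pow, toKxHat_neg_one_sq, map_one]
  have h2 : ((κ (toKxHat X (-1)) : ContH1 (MonoidHom.id P.D) P.ID (⊤ : Subgroup P.D))) ^ 2 = 1 := by
    rw [← Subgroup.coe_pow, h1, Subgroup.coe_one]
  have h3 := P.contH1_eq_one_of_pow_eq_one_of_torsionFree hcomm htf _ two_ne_zero h2
  have h4 : κ (toKxHat X (-1)) = 1 := Subtype.ext h3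
  exact κ.injective (by rw [h4, map_one])

end GalSect.CuspPair

/-! ### §2. The orbicurve cusp pair `(D_C, I_C)` at `inversionModelκ′` -/

namespace SettingModel

open GalSect MuTwoSetting

variable (p : ℕ) [Fact p.Prime]
/-- **`g₁ := inclX(inl(ab))·ε_± ∈ Π^tp_C`** — abc-iut-L2-t5's square root of the cusp generator (`g₁² = inclX(c)`, `sqrtCuspκ_sq`), the extra
generator of the ORBICURVE cusp decomposition group. [cite: MochizukiEtTh2009, Def 1.7 p.27] -/
abbrev sqrtCuspInvκ : (MuTwoSetting.inversionModelκ' p).GtpC :=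
  (MuTwoSetting.inversionModelκ' p).inclX (SemidirectProduct.inl (gfpOf (FreeGroup.of 0 * FreeGroup.of 1))) *
    (MuTwoSetting.inversionModelκ' p).epsPM
/-- **`D_C := Comm_{Π^tp_C}(inclX D_x)`**, the decomposition group of the cusp of the orbicurve `C = X/±1` at `inversionModelκ′` (p455817).
[cite: MochizukiSemiAnbd2006, Thm 6.5 (ii) p.71] -/
abbrev decompCκ' : Subgroup (MuTwoSetting.inversionModelκ' p).GtpC :=
  Subgroup.Commensurable.commensurator ((cuspDecompκ p).map (inclInvκ p))
/-- **The ORBICURVE cusp pair `(D_C, I_C)`**, `I_C := D_C ∩ Ker(augC)` ([GalSect] §4 shape `1 → I → D → G_K → 1` for the cusp of `C`).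
Class (b) datum over abc-iut-w5-d062's `GalSect.CuspPair`. [cite: MochizukiGalSect2005, §4 p.33] -/
def pairCκ' : CuspPair (MuTwoSetting.inversionModelκ' p).GtpC where
  D := decompCκ' p
  I := decompCκ' p ⊓ (augCInvκ p).toMonoidHom.ker
  I_le := inf_le_left
  conj_I d hd := by
    haveI : (augCInvκ p).toMonoidHom.ker.Normal := MonoidHom.normal_ker _
    rw [Subgroup.smul_inf, Subgroup.conj_smul_eq_self_of_mem hd, Subgroup.Normal.conj_smul_eq_self]

/-! #### Membership and centrality -/
/-- `D_C = inclX(D_x) ∪ inclX(D_x)·g₁` (abc-iut-L2-t5's `mem_commensurator_cuspDecompκ_C_iff`, restated over the pushed pair `pairInvκ′`).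
[cite: MochizukiSemiAnbd2006, Thm 6.5 (ii) p.71] -/
theorem mem_decompCκ'_iff (g : (MuTwoSetting.inversionModelκ' p).GtpC) :
    g ∈ decompCκ' p ↔ g ∈ (pairInvκ' p).D ∨ g * (sqrtCuspInvκ p)⁻¹ ∈ (pairInvκ' p).D :=
  mem_commensurator_cuspDecompκ_C_iff p g
/-- `inclX(D_x) ≤ D_C`. [cite: MochizukiSemiAnbd2006, Thm 6.5 (ii) p.71] -/
theorem pairInvκ'_D_le_decompCκ' : (pairInvκ' p).D ≤ decompCκ' p :=
  MuTwoSetting.map_inclX_le_commensurator (M := MuTwoSetting.inversionModelκ' p) (H := cuspDecompκ p)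
/-- `g₁ ∈ D_C`. [cite: MochizukiSemiAnbd2006, Thm 6.5 (ii) p.71] -/
theorem sqrtCuspInvκ_mem_decompCκ' : sqrtCuspInvκ p ∈ decompCκ' p :=
  MuTwoSetting.sqrt_mem_commensurator_map_inclX (M := MuTwoSetting.inversionModelκ' p) (cuspDecompκ p) _
    (epsPM_conj_inclX_of_mem_cuspDecompκ p)
/-- `g₁ ∉ inclX(Π^tp_X)`. [cite: MochizukiEtTh2009, Def 1.7 p.27] -/
theorem sqrtCuspInvκ_not_mem_range : sqrtCuspInvκ p ∉ (MuTwoSetting.inversionModelκ' p).inclX.range := by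
  rw [MonoidHom.range_eq_map]
  exact MuTwoSetting.sqrt_not_mem_map_inclX (M := MuTwoSetting.inversionModelκ' p) ⊤ _
/-- `augC(g₁) = 1` (`aug(inl(ab)) = 1` and `ε_±` is geometric). [cite: MochizukiEtTh2009, Def 1.7 p.27] -/
theorem augC_sqrtCuspInvκ : augCInvκ p (sqrtCuspInvκ p) = 1 := by
  change augCInvκ p (inclInvκ p (SemidirectProduct.inl (gfpOf (FreeGroup.of 0 * FreeGroup.of 1))) * epsPMInvκ p) = 1
  rw [map_mul, augCInvκ_inclInvκ, augCInvκ_epsPMInvκ, augκ_apply, SemidirectProduct.right_inl, mul_one]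
/-- **`g₁` CENTRALISES `inclX(D_x)`** (abc-iut-L2-t5's `sqrt_conj_inclX_eq` at `κ′`). [cite: MochizukiEtTh2009, §2 p.36] -/
theorem sqrtCuspInvκ_conj_eq_of_mem {e : (MuTwoSetting.inversionModelκ' p).GtpC} (he : e ∈ (pairInvκ' p).D) :
    sqrtCuspInvκ p * e * (sqrtCuspInvκ p)⁻¹ = e := by
  obtain ⟨d, hd, rfl⟩ := he
  exact MuTwoSetting.sqrt_conj_inclX_eq (M := MuTwoSetting.inversionModelκ' p) (epsPM_conj_inclX_of_mem_cuspDecompκ p) hd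
/-- … equivalently `inclX(D_x)` centralises `g₁`. [cite: MochizukiEtTh2009, §2 p.36] -/
theorem conj_sqrtCuspInvκ_eq_of_mem {e : (MuTwoSetting.inversionModelκ' p).GtpC} (he : e ∈ (pairInvκ' p).D) :
    e * sqrtCuspInvκ p * e⁻¹ = sqrtCuspInvκ p := by
  have h := sqrtCuspInvκ_conj_eq_of_mem p he
  have h' : sqrtCuspInvκ p * e = e * sqrtCuspInvκ p := by
    calc sqrtCuspInvκ p * e = sqrtCuspInvκ p * e * (sqrtCuspInvκ p)⁻¹ * sqrtCuspInvκ p := by group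
      _ = e * sqrtCuspInvκ p := by rw [h]
  rw [← h', mul_assoc, mul_inv_cancel, mul_one]
/-- **`I_C = inclX(I_x) ∪ inclX(I_x)·g₁`.** [cite: MochizukiGalSect2005, §4 p.33] -/
theorem mem_inertiaCκ'_iff (i : (MuTwoSetting.inversionModelκ' p).GtpC) :
    i ∈ (pairCκ' p).I ↔ i ∈ (pairInvκ' p).I ∨ i * (sqrtCuspInvκ p)⁻¹ ∈ (pairInvκ' p).I := by
  constructor
  · rintro ⟨hD, hker⟩
    have hker' : augCInvκ p i = 1 := hker
    rcases (mem_decompCκ'_iff p i).mp hD with ⟨d, hd, hdi⟩ | ⟨d, hd, hdi⟩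
    · refine Or.inl ⟨d, ⟨hd, ?_⟩, hdi⟩
      have h : augCInvκ p (inclInvκ p d) = 1 := by rw [hdi]; exact hker'
      rw [augCInvκ_inclInvκ] at h
      exact h
    · refine Or.inr ⟨d, ⟨hd, ?_⟩, hdi⟩
      have h : augCInvκ p (inclInvκ p d) = 1 := by
        rw [hdi, map_mul, map_inv, augC_sqrtCuspInvκ, inv_one, mul_one]; exact hker'
      rw [augCInvκ_inclInvκ] at h
      exact h
  · rintro (⟨d, ⟨hd, hk⟩, rfl⟩ | ⟨d, ⟨hd, hk⟩, hdi⟩)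
    · refine ⟨pairInvκ'_D_le_decompCκ' p ⟨d, hd, rfl⟩, ?_⟩
      change augCInvκ p (inclInvκ p d) = 1
      rw [augCInvκ_inclInvκ]; exact hk
    · have hi : i = inclInvκ p d * sqrtCuspInvκ p := by rw [hdi, inv_mul_cancel_right]
      refine ⟨?_, ?_⟩
      · rw [hi]; exact Subgroup.mul_mem _ (pairInvκ'_D_le_decompCκ' p ⟨d, hd, rfl⟩) (sqrtCuspInvκ_mem_decompCκ' p)
      · change augCInvκ p i = 1
        rw [hi, map_mul, augCInvκ_inclInvκ, augC_sqrtCuspInvκ, mul_one]; exact hk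
/-- Every `d ∈ D_C` centralises `g₁`. [cite: MochizukiEtTh2009, §2 p.36] -/
theorem conj_sqrtCuspInvκ_eq_of_mem_decompCκ' {d : (MuTwoSetting.inversionModelκ' p).GtpC} (hd : d ∈ decompCκ' p) :
    d * sqrtCuspInvκ p * d⁻¹ = sqrtCuspInvκ p := by
  rcases (mem_decompCκ'_iff p d).mp hd with he | he
  · exact conj_sqrtCuspInvκ_eq_of_mem p he
  · have hd' : d = d * (sqrtCuspInvκ p)⁻¹ * sqrtCuspInvκ p := by rw [inv_mul_cancel_right]
    have key := conj_sqrtCuspInvκ_eq_of_mem p he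
    calc d * sqrtCuspInvκ p * d⁻¹
        = (d * (sqrtCuspInvκ p)⁻¹) * sqrtCuspInvκ p * (d * (sqrtCuspInvκ p)⁻¹)⁻¹ := by group
      _ = sqrtCuspInvκ p := key
/-- Every `d ∈ D_C` centralises `inclX(I_x)`. [cite: MochizukiEtTh2009, §1 p.13] -/
theorem conj_eq_of_mem_decompCκ'_of_mem_I {d j : (MuTwoSetting.inversionModelκ' p).GtpC} (hd : d ∈ decompCκ' p)
    (hj : j ∈ (pairInvκ' p).I) : d * j * d⁻¹ = j := by
  rcases (mem_decompCκ'_iff p d).mp hd with he | he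
  · exact conj_eq_of_mem_pairInvκ' p he hj
  · have h1 := conj_eq_of_mem_pairInvκ' p he hj
    have h2 := sqrtCuspInvκ_conj_eq_of_mem p ((pairInvκ' p).I_le hj)
    calc d * j * d⁻¹
        = (d * (sqrtCuspInvκ p)⁻¹) * (sqrtCuspInvκ p * j * (sqrtCuspInvκ p)⁻¹) * (d * (sqrtCuspInvκ p)⁻¹)⁻¹ := by group
      _ = j := by rw [h2, h1]
/-- **The orbicurve inertia `I_C` is CENTRAL in `D_C`.** [cite: MochizukiGalSect2005, §4 p.33] -/
theorem conj_eq_of_mem_pairCκ' : ∀ d ∈ (pairCκ' p).D, ∀ i ∈ (pairCκ' p).I, d * i * d⁻¹ = i := by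
  intro d hd i hi
  rcases (mem_inertiaCκ'_iff p i).mp hi with hj | hj
  · exact conj_eq_of_mem_decompCκ'_of_mem_I p hd hj
  · have hi' : i = i * (sqrtCuspInvκ p)⁻¹ * sqrtCuspInvκ p := by rw [inv_mul_cancel_right]
    have h1 := conj_eq_of_mem_decompCκ'_of_mem_I p hd hj
    have h2 := conj_sqrtCuspInvκ_eq_of_mem_decompCκ' p hd
    calc d * i * d⁻¹ = (d * (i * (sqrtCuspInvκ p)⁻¹) * d⁻¹) * (d * sqrtCuspInvκ p * d⁻¹) := by
          conv_lhs => rw [hi']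
          group
      _ = i := by rw [h1, h2, inv_mul_cancel_right]
/-- `augC(D_C) = G_{ℚ_p}`. [cite: MochizukiEtTh2009, §1 p.13] -/
theorem augC_image_decompCκ' : (augCInvκ p).toMonoidHom '' ((pairCκ' p).D : Set (MuTwoSetting.inversionModelκ' p).GtpC) = Set.univ := by
  refine Set.eq_univ_of_forall fun σ => ⟨inclInvκ p (SemidirectProduct.inr σ), ?_, ?_⟩
  · have hmem : (SemidirectProduct.inr σ : PiTpκ p) ∈ cuspDecompκ p := by
      rw [SettingModel.mem_cuspDecompκ_iff, SemidirectProduct.left_inr]; exact Subgroup.one_mem _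
    exact pairInvκ'_D_le_decompCκ' p ⟨SemidirectProduct.inr σ, hmem, rfl⟩
  · change augCInvκ p (inclInvκ p (SemidirectProduct.inr σ)) = σ
    rw [augCInvκ_inclInvκ, augκ_apply, SemidirectProduct.right_inr]

/-! ### §3. Clause (1) at the orbicurve pair: NOT cyclotomic -/
/-- **C7e clause (1) REFUTED at the orbicurve pair `(D_C, I_C)` of `inversionModelκ′`**: central inertia and `augC(D_C) = G_{ℚ_p}` open,
so «`I_C ≅ Ẑ(1)`» fails (my `not_isCyclotomic_of_conj_eq`, p452745). [cite: NeukirchANT1999, Ch. II Prop. (5.7) (i)] -/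
theorem not_isCyclotomic_pairCκ' : ¬ (pairCκ' p).IsCyclotomic (augCInvκ p).toMonoidHom :=
  (pairCκ' p).not_isCyclotomic_of_conj_eq _ (conj_eq_of_mem_pairCκ' p) (by rw [augC_image_decompCκ']; exact isOpen_univ)

/-! ### §4. `I_C` is torsion-free; clause (2) at the orbicurve pair -/
/-- `ε_±² = 1` in `Π^tp_C(κ′)`. [cite: MochizukiEtTh2009, Def 1.7 p.27] -/
theorem epsPMInvκ_mul_self : epsPMInvκ p * epsPMInvκ p = 1 := by
  rw [epsPMInvκ, ← map_mul]
  have h1 : Multiplicative.ofAdd (1 : ZMod 2) * Multiplicative.ofAdd (1 : ZMod 2) = 1 := by decide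
  rw [h1, map_one]
/-- `inclX(I_x) ≅ Ẑ` is torsion-free. [cite: MochizukiSemiAnbd2006, §6 p.71] -/
theorem eq_one_of_mem_pairInvκ'_I_of_pow_eq_one {j : (MuTwoSetting.inversionModelκ' p).GtpC} (hj : j ∈ (pairInvκ' p).I) {n : ℕ}
    (hn : n ≠ 0) (h : j ^ n = 1) : j = 1 := by
  let e : ↥(pairInvκ' p).I ≃* ZHat :=
    ((cuspPairOf (curveκ' p) ()).inertiaEquivPushforward (MuTwoSetting.inversionModelκ' p).continuous_inclX
      ((MuTwoSetting.inversionModelκ' p).isClosedEmbedding_inclX (cLevelDataInvκ' p)).isEmbedding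
      ((curveκ' p).inertia_equiv_zHat () trivial).some).toMulEquiv
  have h1 : (⟨j, hj⟩ : ↥(pairInvκ' p).I) ^ n = 1 := Subtype.ext (by rw [Subgroup.coe_pow, Subgroup.coe_one]; exact h)
  have h2 : e ⟨j, hj⟩ = 1 :=
    Literature.AnabelianGeometry.AbsoluteAnabelian.ZHatCompletion.eq_one_of_pow_eq_one hn (by rw [← map_pow, h1, map_one])
  have h3 : (⟨j, hj⟩ : ↥(pairInvκ' p).I) = 1 := e.injective (by rw [h2, map_one])
  exact congrArg Subtype.val h3

/-- `i² ∈ inclX(I_x)` for `i ∈ I_C` (`i² ∈ inclX(Π^tp_X)` by the index-`2` square law of `MuTwoSetting`, and `g₁ ∉ inclX(Π^tp_X)`).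
[cite: MochizukiEtTh2009, Def 1.7 p.27] -/
theorem mul_self_mem_pairInvκ'_I_of_mem_inertiaCκ' {i : (MuTwoSetting.inversionModelκ' p).GtpC} (hi : i ∈ (pairCκ' p).I) :
    i * i ∈ (pairInvκ' p).I := by
  have hsq : i * i ∈ (MuTwoSetting.inversionModelκ' p).inclX.range :=
    Subgroup.map_le_range _ _ ((MuTwoSetting.inversionModelκ' p).sq_mem_GtpXdd i)
  rcases (mem_inertiaCκ'_iff p (i * i)).mp (Subgroup.mul_mem _ hi hi) with h | h
  · exact h
  · exfalso
    apply sqrtCuspInvκ_not_mem_range p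
    have hr : i * i * (sqrtCuspInvκ p)⁻¹ ∈ (MuTwoSetting.inversionModelκ' p).inclX.range := by
      obtain ⟨d, -, hd⟩ := h
      exact ⟨d, hd⟩
    have key : sqrtCuspInvκ p = (i * i * (sqrtCuspInvκ p)⁻¹)⁻¹ * (i * i) := by group
    rw [key]
    exact Subgroup.mul_mem _ (Subgroup.inv_mem _ hr) hsq

/-- `c = c^{η(1)}` in `Γ = F̂₂ ×_Ẑ ℤ`: `gfpOf ⁅a, b⁆ = cPowGfp (ι 1)` (the `a`-exponent of a commutator vanishes). [cite: MochizukiEtTh2009, Def 2.1 p.35] -/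
theorem gfpOf_cElt_eq_cPowGfp : gfpOf cElt = cPowGfp (iotaZ (Multiplicative.ofAdd 1)) := by
  apply Subtype.ext
  refine Prod.ext ?_ ?_
  · change eta cElt = cPow (iotaZ (Multiplicative.ofAdd 1))
    exact cPow_spec.symm
  · change expA ⁅FreeGroup.of (0 : Fin 2), FreeGroup.of 1⁆ = 1
    rw [map_commutatorElement, commutatorElement_eq_one_iff_commute]
    exact Commute.all _ _

/-- `g₁ · g₁ = inclX(inl(c^{η(1)}))`. [cite: MochizukiEtTh2009, Def 1.7 p.27] -/
theorem sqrtCuspInvκ_mul_self :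
    sqrtCuspInvκ p * sqrtCuspInvκ p =
      (MuTwoSetting.inversionModelκ' p).inclX (SemidirectProduct.inl (cPowGfp (iotaZ (Multiplicative.ofAdd 1)))) := by
  rw [← pow_two, ← gfpOf_cElt_eq_cPowGfp]
  exact sqrtCuspκ_sq p

/-- `level₂(t·t·η(1)) ≠ 1`: «`2t + 1 ≡ 1 (mod 2)`». [cite: RibesZalesskii2010, Thm 2.7.1] -/
theorem level_two_mul_self_mul_iotaZ_one_ne_one (t : ZH) :
    ZHatLevel.level 2 (t * t * iotaZ (Multiplicative.ofAdd 1)) ≠ 1 := by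
  rw [map_mul, map_mul, iotaZ_one_eq, ZHatLevel.level_eta, Int.cast_one]
  generalize ZHatLevel.level 2 t = m
  revert m; decide

/-- **The orbicurve inertia `I_C` is TORSION-FREE**: the square root `g₁` of `c` adds no torsion — an `i = inclX(inl c^t)·g₁` with `i² = 1` would
give `c^{t·t·η(1)} = 1`, i.e. «`2t + 1 = 0`» in `Ẑ`, impossible at level `2`. [cite: MochizukiGalSect2005, §4 p.33] -/
theorem eq_one_of_pow_eq_one_inertiaCκ' :
    ∀ i ∈ (pairCκ' p).I, ∀ n : ℕ, n ≠ 0 → i ^ n = 1 → i = 1 := by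
  intro i hi n hn h
  -- `i² = 1`
  have hsq : i * i = 1 := by
    refine eq_one_of_mem_pairInvκ'_I_of_pow_eq_one p (mul_self_mem_pairInvκ'_I_of_mem_inertiaCκ' p hi) hn ?_
    rw [← pow_two, ← pow_mul, mul_comm, pow_mul, h, one_pow]
  rcases (mem_inertiaCκ'_iff p i).mp hi with hj | hj
  · exact eq_one_of_mem_pairInvκ'_I_of_pow_eq_one p hj two_ne_zero (by rw [pow_two, hsq])
  · exfalso
    -- `i = inclX(inl q)·g₁` with `q = c^t`
    obtain ⟨d₀, hd₀, hd₀i⟩ := hj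
    have hd₀' : d₀ ∈ cuspDecompκ p ⊓ (augκ p).toMonoidHom.ker := hd₀
    rw [cuspDecompκ_inf_ker] at hd₀'
    obtain ⟨q, ⟨t, rfl⟩, rfl⟩ := hd₀'
    have hi' : i = (MuTwoSetting.inversionModelκ' p).inclX (SemidirectProduct.inl (cPowGfp t)) * sqrtCuspInvκ p := by
      calc i = i * (sqrtCuspInvκ p)⁻¹ * sqrtCuspInvκ p := by rw [inv_mul_cancel_right]
        _ = _ := by rw [← hd₀i]; rfl
    -- `g₁` commutes with `inclX(inl c^t)`
    have hcomm : sqrtCuspInvκ p * (MuTwoSetting.inversionModelκ' p).inclX (SemidirectProduct.inl (cPowGfp t)) =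
        (MuTwoSetting.inversionModelκ' p).inclX (SemidirectProduct.inl (cPowGfp t)) * sqrtCuspInvκ p := by
      have hmem : (MuTwoSetting.inversionModelκ' p).inclX (SemidirectProduct.inl (cPowGfp t)) ∈ (pairInvκ' p).D :=
        ⟨SemidirectProduct.inl (cPowGfp t), by
          change (SemidirectProduct.inl (cPowGfp t) : PiTpκ p).left ∈ cAxisGfp
          rw [SemidirectProduct.left_inl]; exact ⟨t, rfl⟩, rfl⟩
      have h1 := sqrtCuspInvκ_conj_eq_of_mem p hmem
      calc sqrtCuspInvκ p * (MuTwoSetting.inversionModelκ' p).inclX (SemidirectProduct.inl (cPowGfp t))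
          = sqrtCuspInvκ p * (MuTwoSetting.inversionModelκ' p).inclX (SemidirectProduct.inl (cPowGfp t)) *
              (sqrtCuspInvκ p)⁻¹ * sqrtCuspInvκ p := by group
        _ = _ := by rw [h1]
    -- `i·i = inclX(inl(c^{t·t·η 1}))`
    have hii : i * i = (MuTwoSetting.inversionModelκ' p).inclX
        (SemidirectProduct.inl (cPowGfp (t * t * iotaZ (Multiplicative.ofAdd 1)))) := by
      rw [hi', mul_assoc, ← mul_assoc (sqrtCuspInvκ p), hcomm, mul_assoc, sqrtCuspInvκ_mul_self]
      simp only [map_mul, mul_assoc]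
    rw [hsq] at hii
    have hinj : cPowGfp (t * t * iotaZ (Multiplicative.ofAdd 1)) = 1 := by
      have h1 := (MuTwoSetting.inversionModelκ' p).injective_inclX (hii.symm.trans (map_one _).symm)
      exact SemidirectProduct.inl_injective (h1.trans (map_one _).symm)
    have hzh : t * t * iotaZ (Multiplicative.ofAdd 1) = 1 := cPowGfp_injective (hinj.trans (map_one _).symm)
    exact level_two_mul_self_mul_iotaZ_one_ne_one t (by rw [hzh, (ZHatLevel.level 2).map_one])

/-- **C7e clause (2) REFUTED at the orbicurve pair**: there is NO identification of structure groups `(ℚ_pˣ)^∧ ≃* Ker(res)` for `(D_C, I_C)`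
(central torsion-free inertia vs `η(−1)` of order `2`). [cite: MochizukiGalSect2005, §4 p.33] -/
theorem isEmpty_structureGroupIso_pairCκ' :
    haveI := (pairCκ' p).isMulCommutative_I_of_conj_eq (conj_eq_of_mem_pairCκ' p)
    haveI := (pairCκ' p).ID_normal
    IsEmpty (KxHat (curveκ' p) ≃* ↥(ContH1.resKer (pairCκ' p).ID (⊤ : Subgroup (pairCκ' p).D) le_top)) :=
  haveI := (pairCκ' p).isMulCommutative_I_of_conj_eq (conj_eq_of_mem_pairCκ' p)
  (pairCκ' p).isEmpty_kxHat_mulEquiv_resKer_of_torsionFree (curveκ' p) (conj_eq_of_mem_pairCκ' p)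
    (eq_one_of_pow_eq_one_inertiaCκ' p) le_top

/-! ### §5. Every `DotCCusp` at `κ′` whose pair has `D = D_C` -/

/-- **The C-level augmentation is UNIQUE**: any homomorphism `Π^tp_C(κ′) → G_{ℚ_p}` extending `aug` along `inclX` IS `augC` — on the coset
`inclX(Π^tp_X)·ε_±` the value at `ε_±` is an involution of `G_{ℚ_p}`, hence `1` (abc-iut-w6-d067, Artin–Schreier at `ℚ̄_p/ℚ_p`).
[cite: MochizukiEtTh2009, Def 1.7 p.27] -/
theorem augC_eq_of_comp_inclX (α : (MuTwoSetting.inversionModelκ' p).GtpC →* GQp p)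
    (hα : ∀ x, α ((MuTwoSetting.inversionModelκ' p).inclX x) = (MuTwoSetting.inversionModelκ' p).aug x) :
    α = (augCInvκ p).toMonoidHom := by
  have hε : α (MuTwoSetting.inversionModelκ' p).epsPM = 1 := by
    apply Literature.FieldTheory.AlgEquiv.eq_one_of_mul_self_eq_one_padic p
    rw [← map_mul]
    change α (epsPMInvκ p * epsPMInvκ p) = 1
    rw [epsPMInvκ_mul_self, map_one]
  refine MonoidHom.ext fun g => ?_
  rcases MuTwoSetting.mem_range_inclX_or_mul_epsPM_inv_mem (MuTwoSetting.inversionModelκ' p) g with ⟨x, rfl⟩ | ⟨x, hx⟩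
  · rw [hα]
    change (MuTwoSetting.inversionModelκ' p).aug x = augCInvκ p (inclInvκ p x)
    rw [augCInvκ_inclInvκ]
  · have hg : g = (MuTwoSetting.inversionModelκ' p).inclX x * (MuTwoSetting.inversionModelκ' p).epsPM := by
      rw [hx, inv_mul_cancel_right]
    rw [hg, map_mul, map_mul, hα, hε, mul_one]
    change (MuTwoSetting.inversionModelκ' p).aug x = augCInvκ p (inclInvκ p x) * augCInvκ p (epsPMInvκ p)
    rw [augCInvκ_inclInvκ, augCInvκ_epsPMInvκ, mul_one]

/-- **C7e clause (1) fails for EVERY cusp datum at `inversionModelκ′` whose pair has `D = D_C`** (whatever its fields `augC`, `I`, …: the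
augmentation is forced, hence `I = I_C`). [cite: MochizukiEtTh2009, Thm 1.10 (iii) p.30] -/
theorem not_isCyclotomicInertia_of_pair_D_eq_decompCκ' {εZ : (MuTwoSetting.inversionModelκ' p).GtpC}
    (C : (MuTwoSetting.inversionModelκ' p).DotCCusp εZ) (hD : C.pair.D = decompCκ' p) : ¬ C.IsCyclotomicInertia := by
  have haug : C.augC = (augCInvκ p).toMonoidHom := augC_eq_of_comp_inclX p C.augC C.augC_inclX
  have hpair : C.pair = pairCκ' p :=
    GalSect.CuspPair.ext' hD (by rw [C.I_eq, hD, haug]; rfl)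
  unfold MuTwoSetting.DotCCusp.IsCyclotomicInertia
  rw [hpair, haug]
  exact not_isCyclotomic_pairCκ' p

/-- **… and clause (2): no identification of structure groups for its pair either.** [cite: MochizukiEtTh2009, Thm 1.10 (iii) p.30] -/
theorem isEmpty_structureGroupIso_of_pair_D_eq_decompCκ' {εZ : (MuTwoSetting.inversionModelκ' p).GtpC}
    (C : (MuTwoSetting.inversionModelκ' p).DotCCusp εZ) (hD : C.pair.D = decompCκ' p) :
    haveI := C.isMulCommutative_I
    haveI := C.pair.ID_normal
    IsEmpty (KxHat (curveκ' p) ≃* ↥(ContH1.resKer C.pair.ID (⊤ : Subgroup C.pair.D) le_top)) := by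
  have haug : C.augC = (augCInvκ p).toMonoidHom := augC_eq_of_comp_inclX p C.augC C.augC_inclX
  have hpair : C.pair = pairCκ' p :=
    GalSect.CuspPair.ext' hD (by rw [C.I_eq, hD, haug]; rfl)
  have hcomm : ∀ d ∈ C.pair.D, ∀ i ∈ C.pair.I, d * i * d⁻¹ = i := by rw [hpair]; exact conj_eq_of_mem_pairCκ' p
  have htf : ∀ i ∈ C.pair.I, ∀ n : ℕ, n ≠ 0 → i ^ n = 1 → i = 1 := by rw [hpair]; exact eq_one_of_pow_eq_one_inertiaCκ' p
  haveI := C.isMulCommutative_I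
  exact C.pair.isEmpty_kxHat_mulEquiv_resKer_of_torsionFree (curveκ' p) hcomm htf le_top

end SettingModel

end Literature.AnabelianGeometry.EtaleTheta

end
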